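/-
Copyright (c) 2026 the pub-hodgecm-mathlib formalisation cell (harness21).  Prover seat hodgecm-mathlib-LH4-p02 (g12): STAGE 1a «(D-RAM) FOUR-FRAME» squad of
crux H413 (director s1808; heir LEAD F0P3a-plan (g18) T17-27 DIRECTIVE b9ecbbedecc9c5ae D3; dealer LH4-plan (g10) deal g10-#2 «(ii-0) htr₂-WILD»), FILE 2 of 2
«TYPE-TWO TRANSITIVITY AT A WILD RAMIFIED PLACE»; 2026-09-03.  §3 is ADAPTED from ★ F0P3a-p07 (g11) `UnitaryLatticeTreeTypeTwoTransitiveRamified` §5 (itself adapted from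
★ B-p14 (g35) `UnitaryLatticeTreeTypeTwoTransitive` §38) with `σϖ` kept general; §1–§2 (the adapted vectors through a primitive isotropic vector) are new.
-/
import Literature.NumberTheory.Automorphic.UnitaryLatticeTreeTypeTwoGramWild               -- htr₂-wild FILE 1 (this seat): `exists_orthogonal_basis_of_adjugate`, `typeTwo_block_of_ramified`, `exists_norm_add_trace_eq_zero_of_ramified`
import Literature.NumberTheory.Automorphic.UnitaryLatticeTreeTypeTwoTransitiveRamified     -- ★ tame twin (F0P3a-p07 (g11)); brings ★ `UnitaryLatticeTreeTypeTwoTransitive` (`B₀_mulVec_single_eq_gram`, `transpose_of_mulVec_single`, `det_gram_three`, `det_antidiagonal_three`)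
import Literature.NumberTheory.Automorphic.UnitaryLatticeTreeApartmentOfInvolution         -- ★ `isVertexLattice_two_N₁_of_v` (`N₁` is type two for ANY valuation-preserving `σ`)
import Literature.NumberTheory.Automorphic.HyperspecialUnitaryIwasawa                      -- ★ `exists_inv_smul_mem_stdLattice` (primitive normalisation), `B₀_single_single_self_eq_zero`
import HarnessLib

/-!
# The lattice graph of a hermitian space — htr₂-wild FILE 2: `U(σ, J₀)` IS TRANSITIVE ON THE TYPE-TWO VERTICES AT EVERY RAMIFIED PLACE, WILD ONES INCLUDED
# (Jacobowitz 1962 §§9–11, Thm. 11.4; Bruhat–Tits 1972 §10)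

Topic `NumberTheory/Automorphic`; namespace `Literature.NumberTheory.Automorphic.UnitaryLatticeTree`.  THEOREMS ONLY (no definition, no instance, no notation, no named fact,
no `sorry`); kernel lane.  Cell `pub/hodgecm-mathlib` (D-0151), crux H413 = `stmt-HodgeConjecture-24833`; road «(D-RAM) FOUR-FRAME» (STAGE 1a), unit (ii-0), brick
**htr₂-wild**: the binder `htr₂` of ★ `isTree_latticeGraph_three_of_transitive` (`UnitaryLatticeTreeFramesOfInvolution` §3) — «every type-two vertex of `(K³, J₀)` is `u·N₁`,
`N₁ = latt diag(1,1,ϖ)`, `u ∈ U(σ, J₀)`» — at EVERY ramified place of the cell's datum: tame, ramified-prime AND ramified-unit dyadic alike.  HYPOTHESES (⊆ the conjuncts of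
`IsRamifiedQuadraticDatum σ ϖ d t` + a finite residue field): `σ` an involution preserving `v`, `ϖ` a uniformiser, `σ` residually trivial (`hres`), non-zero `σ`-fixed elements have
even valuation (`heven`), `2 ≠ 0`.  NO `|2| = 1`, NO `σϖ = −ϖ`, NO first-order norm property, NO `d`-parity: there is NO second `U(σ,J₀)`-orbit of type-two vertices at a
ramified-unit place (the anisotropic `ϖ`-modular planes of Jacobowitz Prop. 9.2 are absorbed by re-splitting the rank-one unimodular Jordan component; Jacobowitz's invariants
(type, `u(1) = 0`, `u(2) = 2`, `dL₁∕dK₁ ≡ 1 (mod 𝔭²)`) of any type-two vertex and of `N₁` coincide — Thm. 11.4).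
THE MATHEMATICS.  `M` a type-two vertex.  FILE 1 gives an orthogonal basis `x ⊥ c₁, c₂` of `M` with `|h(x,x)| = 1`, `|h(c_a,c_a)| ≤ |ϖ|²`, `|h(c₁,c₂)| = |ϖ|`.  At a wild place
the `ϖ`-modular plane `x^⊥ ∩ M` may be ANISOTROPIC (e.g. `⟨5⟩ ⊥ [[2,√2],[−√2,4]]` in `(ℚ₂(√2)³, J₀)`), so the tame route (isotropy inside `x^⊥`) is abandoned: (§1) `f₀ :=` the
PRIMITIVE multiple of the isotropic vector `e₀` in `M` (★ `exists_inv_smul_mem_stdLattice` on the coordinates `g⁻¹e₀`); writing `f₀ = w₀x + w₁c₁ + w₂c₂`, isotropy forces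
`|w₀| ≤ |ϖ|`, so `w₁` or `w₂` is a unit and the corresponding `u = h(f₀, c_a)` has `|u| = |ϖ|`; `y = (ϖ∕u)c_a` gives `h(f₀,y) = ϖ`, and `z = x − (h(f₀,x)∕ϖ)·y ⊥ f₀` is a NEW unit
vector (`h(x,y) = 0`); `y′ = y − (h(z,y)∕h(z,z))·z ⊥ z` leaves the `σ`-fixed defect `b = h(y′,y′)`, `|b| ≤ |ϖ|²`, which FILE 1's NORM–TRACE DESCENT writes as
`−h(z,z)·N(γ) − (νσϖ + σνϖ)`, `γ ∈ ϖ𝒪`, `ν ∈ 𝒪`: then `f₂ = y′ + γz + νf₀` is isotropic with `h(f₀,f₂) = ϖ`, and `x′ = z − (σγ·h(z,z)∕σϖ)·f₀` is a unit vector orthogonal to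
`f₀, f₂` (§2: the ADAPTED VECTORS `x′, f₀, f₂ ∈ M`).  (§3) ★'s determinant class: `Gram(f₀ | x′ | f₂) = [[0,0,ϖ],[0,ε′,0],[σϖ,0,0]]` has determinant `−ε′ϖσϖ = −N(det C)`, so
`ε′ = N(det C ∕ ϖ)`; `u = (f₀ | z⁻¹x′ | ϖ⁻¹f₂) ∈ U(σ, J₀)` and `u·N₁ ≤ M`, two type-two vertices (★ `isVertexLattice_two_N₁_of_v`), equal by ★ `eq_of_le_of_isVertexLattice`.
HONEST LABEL: HC_CM is proved only modulo the 7 printed citations (2 remaining: hLiu418 = stmt-HodgeConjecture-24832, h413 = stmt-HodgeConjecture-24833) until rung 0 closes; nothing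
printed is asserted here; (D-RAM) `stub_DyRamCore` stays PRINT until the road's END lands.

* §1 **`exists_adapted_vectors_of_isotropic_of_ramified`** (vector form: from `x, f₀, c` to `x′, f₀, f₂`), **`exists_adapted_vectors_of_frame_of_ramified`** (the case analysis on
  the unit coordinate).  §2 **`exists_adapted_vectors_of_isVertexLattice_two_of_ramified`**.
* §3 **`exists_mapGL_N₁_eq_of_isVertexLattice_two_of_ramified`**, **`forall_isVertexLattice_two_exists_mapGL_N₁_eq_of_ramified`** (= «htr₂-wild», the `htr₂` binder of ★ :266).

## References
* [Jacobowitz1962] R. Jacobowitz, *Hermitian forms over local fields*, Amer. J. Math. 84 (1962), §4, §§9–11 (ramified dyadic; Prop. 9.2, Prop. 10.2, Thm. 11.4).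
* [Omeara1963] O. T. O'Meara, *Introduction to Quadratic Forms* (1963), §81A (primitive vectors), §82F, §93.
* [BruhatTits1972] F. Bruhat, J. Tits, *Groupes réductifs sur un corps local I*, Publ. Math. IHÉS 41 (1972), §10.  [Tits1979] J. Tits, *Reductive groups over local fields*, §2.4.
-/

set_option autoImplicit false

noncomputable section

open scoped Valued WithZero Matrix MatrixGroups

namespace Literature.NumberTheory.Automorphic.UnitaryLatticeTree

open Literature.NumberTheory.Automorphic Literature.NumberTheory.Automorphic.HermitianLattice Literature.NumberTheory.Automorphic.CartanUnique

variable {K : Type*} [Field K] [Valued K ℤᵐ⁰] {σ : K →+* K} {ϖ : K}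

/-! ## §1 Adapted vectors through a primitive isotropic vector (vector form, any rank) -/

/-- **ADAPTED VECTORS FROM `x, f₀, c`** (any rank `N`).  `x, f₀, c ∈ M` with `|h(x,x)| = 1`, `h(f₀,f₀) = 0`, `h(x,c) = 0`, `|h(f₀,x)| ≤ |ϖ|`, `|h(f₀,c)| = |ϖ|`, `|h(c,c)| ≤ |ϖ|²`, at a
ramified place with finite residue field (`hres`, `heven`, `2 ≠ 0`).  Then there are `x′, f₂ ∈ M` with `|h(x′,x′)| = 1`, `x′ ⊥ f₀, f₂`, `h(f₂,f₂) = 0`, `h(f₀,f₂) = ϖ`: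
`y = (ϖ∕h(f₀,c))·c`, `z = x − (h(f₀,x)∕ϖ)·y`, `y′ = y − (h(z,y)∕h(z,z))·z`, then FILE 1's norm–trace descent on `b = h(y′,y′)` and `e = h(z,z)` gives `γ, ν`, and
`f₂ = y′ + γz + νf₀`, `x′ = z − (σγ·h(z,z)∕σϖ)·f₀`. [cite: Jacobowitz1962, §9, §11] [cite: Omeara1963, §82F] -/
theorem exists_adapted_vectors_of_isotropic_of_ramified {N : ℕ} [Finite 𝓀[K]] (hσ : ∀ x, σ (σ x) = x) (hvσ : ∀ a, Valued.v (σ a) = Valued.v a)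
    (hϖ : Valued.v ϖ = WithZero.exp (-1 : ℤ)) (hres : ∀ x : K, Valued.v x ≤ 1 → Valued.v (σ x - x) < 1)
    (heven : ∀ x : K, σ x = x → x ≠ 0 → ∃ n : ℤ, Valued.v x = WithZero.exp (2 * n)) (h20 : (2 : K) ≠ 0)
    (M : Submodule 𝒪[K] (Fin N → K)) {x f₀ c : Fin N → K} (hxM : x ∈ M) (hf₀M : f₀ ∈ M) (hcM : c ∈ M)
    (hx : Valued.v (B₀ σ N x x) = 1) (hf₀f₀ : B₀ σ N f₀ f₀ = 0) (hxc : B₀ σ N x c = 0) (hf₀x : Valued.v (B₀ σ N f₀ x) ≤ Valued.v ϖ)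
    (hf₀c : Valued.v (B₀ σ N f₀ c) = Valued.v ϖ) (hcc : Valued.v (B₀ σ N c c) ≤ Valued.v ϖ ^ 2) :
    ∃ x' f₂ : Fin N → K, x' ∈ M ∧ f₂ ∈ M ∧ Valued.v (B₀ σ N x' x') = 1 ∧ B₀ σ N x' f₀ = 0 ∧ B₀ σ N x' f₂ = 0 ∧ B₀ σ N f₂ f₂ = 0 ∧ B₀ σ N f₀ f₂ = ϖ := by
  have hϖ0 : ϖ ≠ 0 := uniformizer_ne_zero hϖ
  have hvϖ0 : Valued.v ϖ ≠ 0 := (Valuation.ne_zero_iff Valued.v).2 hϖ0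
  have hσϖ0 : σ ϖ ≠ 0 := (map_ne_zero σ).2 hϖ0
  have hϖ1 : Valued.v ϖ < 1 := by rw [hϖ, ← WithZero.exp_zero, WithZero.exp_lt_exp]; omega
  have hϖ2 : Valued.v ϖ ^ 2 < 1 := pow_lt_one' hϖ1 two_ne_zero
  have herm : ∀ y z : Fin N → K, B₀ σ N z y = σ (B₀ σ N y z) := fun y z => (isHermitianForm_B₀ hσ y z).symm
  -- the partner `y = (ϖ/u)·c`, `h(f₀,y) = ϖ`
  set u : K := B₀ σ N f₀ c with hu
  have hu0 : u ≠ 0 := fun h => by rw [h, map_zero] at hf₀c; exact hvϖ0 hf₀c.symm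
  have hvq : Valued.v (ϖ / u) = 1 := by rw [map_div₀, hf₀c, div_self hvϖ0]
  set y : Fin N → K := (ϖ / u) • c with hy
  have hyM : y ∈ M := smul_mem_of_v_le _ hvq.le hcM
  have hf₀y : B₀ σ N f₀ y = ϖ := by rw [hy, form_smul_right, ← hu, div_mul_cancel₀ _ hu0]
  have hxy : B₀ σ N x y = 0 := by rw [hy, form_smul_right, hxc, mul_zero]
  have hyx : B₀ σ N y x = 0 := by rw [herm, hxy, map_zero]
  have hyf₀ : B₀ σ N y f₀ = σ ϖ := by rw [herm, hf₀y]
  have hyy : Valued.v (B₀ σ N y y) ≤ Valued.v ϖ ^ 2 := by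
    rw [hy, form_smul_left, form_smul_right, map_mul, map_mul, hvσ, hvq, one_mul, one_mul]; exact hcc
  -- the new unit vector `z = x − λ·y ⊥ f₀`
  set lam : K := B₀ σ N f₀ x / ϖ with hlam
  have hvlam : Valued.v lam ≤ 1 := by rw [hlam, map_div₀]; exact div_le_one_of_le₀ hf₀x zero_le
  set z : Fin N → K := x - lam • y with hz
  have hzM : z ∈ M := M.sub_mem hxM (smul_mem_of_v_le _ hvlam hyM)
  have hf₀z : B₀ σ N f₀ z = 0 := by rw [hz, map_sub, form_smul_right, hf₀y, hlam, div_mul_cancel₀ _ hϖ0, sub_self]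
  have hzf₀ : B₀ σ N z f₀ = 0 := by rw [herm, hf₀z, map_zero]
  have hzz : B₀ σ N z z = B₀ σ N x x + σ lam * lam * B₀ σ N y y := by
    simp only [hz, map_sub, LinearMap.sub_apply, form_smul_left, form_smul_right, hxy, hyx]; ring
  have hvz : Valued.v (B₀ σ N z z) = 1 := by
    rw [hzz]
    refine (Valuation.map_add_eq_of_lt_left _ ?_).trans hx
    rw [hx, map_mul, map_mul, hvσ]
    calc Valued.v lam * Valued.v lam * Valued.v (B₀ σ N y y) ≤ 1 * 1 * Valued.v ϖ ^ 2 := mul_le_mul' (mul_le_mul' hvlam hvlam) hyy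
      _ < 1 := by rw [one_mul, one_mul]; exact hϖ2
  set e : K := B₀ σ N z z with he
  have he0 : e ≠ 0 := fun h => by rw [h, map_zero] at hvz; exact zero_ne_one hvz
  have hσe : σ e = e := (isHermitianForm_B₀ hσ).apply_self z
  -- `y′ = y − μ z ⊥ z`, its defect `b`
  have hzy : B₀ σ N z y = -(σ lam * B₀ σ N y y) := by
    simp only [hz, map_sub, LinearMap.sub_apply, form_smul_left, hxy]; ring
  have hvzy : Valued.v (B₀ σ N z y) ≤ Valued.v ϖ ^ 2 := by
    rw [hzy, Valuation.map_neg, map_mul, hvσ]; exact (mul_le_of_le_one_left' hvlam).trans hyy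
  set μ : K := B₀ σ N z y / e with hμ
  have hvμ : Valued.v μ ≤ Valued.v ϖ ^ 2 := by rw [hμ, map_div₀, hvz, div_one]; exact hvzy
  have hvμ1 : Valued.v μ ≤ 1 := hvμ.trans hϖ2.le
  set y' : Fin N → K := y - μ • z with hy'
  have hy'M : y' ∈ M := M.sub_mem hyM (smul_mem_of_v_le _ hvμ1 hzM)
  have hzy' : B₀ σ N z y' = 0 := by rw [hy', map_sub, form_smul_right (B₀ σ N) μ z z, hμ, ← he, div_mul_cancel₀ _ he0, sub_self]
  have hy'z : B₀ σ N y' z = 0 := by rw [herm, hzy', map_zero]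
  have hf₀y' : B₀ σ N f₀ y' = ϖ := by rw [hy', map_sub, form_smul_right (B₀ σ N) μ f₀ z, hf₀y, hf₀z, mul_zero, sub_zero]
  have hy'f₀ : B₀ σ N y' f₀ = σ ϖ := by rw [herm, hf₀y']
  set b : K := B₀ σ N y' y' with hb
  have hσb : σ b = b := (isHermitianForm_B₀ hσ).apply_self y'
  have hvb : Valued.v b ≤ Valued.v ϖ ^ 2 := by
    have hexp : b = B₀ σ N y y - μ * B₀ σ N y z - σ μ * B₀ σ N z y + σ μ * μ * e := by
      simp only [hb, hy', he, map_sub, LinearMap.sub_apply, form_smul_left, form_smul_right]; ring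
    rw [hexp]
    refine (Valuation.map_add _ _ _).trans (max_le ((Valuation.map_sub _ _ _).trans (max_le ((Valuation.map_sub _ _ _).trans (max_le hyy ?_)) ?_)) ?_)
    · rw [map_mul, herm, hvσ]; exact (mul_le_of_le_one_left' hvμ1).trans hvzy
    · rw [map_mul, hvσ]; exact (mul_le_of_le_one_left' hvμ1).trans hvzy
    · rw [map_mul, map_mul, hvσ, hvz, mul_one]; exact (mul_le_of_le_one_left' hvμ1).trans hvμ
  -- the norm–trace descent kills the defect
  obtain ⟨γ, ν, hγ, hν, hkill⟩ := exists_norm_add_trace_eq_zero_of_ramified hσ hvσ hϖ hres heven h20 hσe hvz hσb hvb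
  have hγ1 : Valued.v γ ≤ 1 := hγ.trans hϖ1.le
  set f₂ : Fin N → K := y' + γ • z + ν • f₀ with hf₂
  have hf₂M : f₂ ∈ M := M.add_mem (M.add_mem hy'M (smul_mem_of_v_le _ hγ1 hzM)) (smul_mem_of_v_le _ hν hf₀M)
  set δ : K := -(σ γ * e / σ ϖ) with hδ
  have hvδ : Valued.v δ ≤ 1 := by
    rw [hδ, Valuation.map_neg, map_div₀, map_mul, hvσ, hvσ, hvz, mul_one]; exact div_le_one_of_le₀ hγ zero_le
  have hσδ : σ δ = -(γ * e / ϖ) := by rw [hδ, map_neg, map_div₀, map_mul, hσ, hσ, hσe]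
  set x' : Fin N → K := z + δ • f₀ with hx'
  have hx'M : x' ∈ M := M.add_mem hzM (smul_mem_of_v_le _ hvδ hf₀M)
  refine ⟨x', f₂, hx'M, hf₂M, ?_, ?_, ?_, ?_, ?_⟩
  · have h : B₀ σ N x' x' = e := by
      simp only [hx', he, map_add, LinearMap.add_apply, form_smul_left, form_smul_right, hzf₀, hf₀z, hf₀f₀]; ring
    rw [h]; exact hvz
  · rw [hx', map_add, LinearMap.add_apply, form_smul_left, hzf₀, hf₀f₀, mul_zero, add_zero]
  · have h : B₀ σ N x' f₂ = γ * e + σ δ * ϖ := by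
      simp only [hx', hf₂, he, map_add, LinearMap.add_apply, form_smul_left, form_smul_right, hzy', hzf₀, hf₀y', hf₀z, hf₀f₀]; ring
    rw [h, hσδ]; field_simp; ring
  · have h : B₀ σ N f₂ f₂ = b + e * (σ γ * γ) + (ν * σ ϖ + σ ν * ϖ) := by
      simp only [hf₂, hb, he, map_add, LinearMap.add_apply, form_smul_left, form_smul_right, hy'z, hzy', hy'f₀, hf₀y', hzf₀, hf₀z, hf₀f₀]; ring
    rw [h]; exact hkill
  · rw [hf₂, map_add, map_add, form_smul_right, form_smul_right, hf₀y', hf₀z, hf₀f₀, mul_zero, mul_zero, add_zero, add_zero]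

/-- **ADAPTED VECTORS FROM AN ORTHOGONAL FRAME AND AN INTEGRAL ISOTROPIC COMBINATION** (any rank `N`).  `x, c₁, c₂ ∈ M` with `|h(x,x)| = 1`, `h(x,c₁) = h(x,c₂) = 0`,
`|h(c₁,c₁)|, |h(c₂,c₂)| ≤ |ϖ|²`, `|h(c₁,c₂)| = |h(c₂,c₁)| = |ϖ|` (the type-two block of FILE 1 at a ramified place); `w ∈ 𝒪³` with a unit coordinate and
`f₀ = w₀x + w₁c₁ + w₂c₂` ISOTROPIC.  Then isotropy forces `|w₀| ≤ |ϖ|` (`ε·N(w₀) = −(w₁h(f₀,c₁) + w₂h(f₀,c₂)) ∈ ϖ𝒪`), so `w₁` or `w₂` is a unit, and then `|h(f₀,c₂)| = |ϖ|`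
resp. `|h(f₀,c₁)| = |ϖ|` — `exists_adapted_vectors_of_isotropic_of_ramified` applies with `c = c₂` resp. `c = c₁`. [cite: Jacobowitz1962, §9, §11] [cite: Omeara1963, §82F] -/
theorem exists_adapted_vectors_of_frame_of_ramified {N : ℕ} [Finite 𝓀[K]] (hσ : ∀ x, σ (σ x) = x) (hvσ : ∀ a, Valued.v (σ a) = Valued.v a)
    (hϖ : Valued.v ϖ = WithZero.exp (-1 : ℤ)) (hres : ∀ x : K, Valued.v x ≤ 1 → Valued.v (σ x - x) < 1)
    (heven : ∀ x : K, σ x = x → x ≠ 0 → ∃ n : ℤ, Valued.v x = WithZero.exp (2 * n)) (h20 : (2 : K) ≠ 0)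
    (M : Submodule 𝒪[K] (Fin N → K)) {x c₁ c₂ : Fin N → K} (hxM : x ∈ M) (hc₁M : c₁ ∈ M) (hc₂M : c₂ ∈ M)
    (hx : Valued.v (B₀ σ N x x) = 1) (hxc₁ : B₀ σ N x c₁ = 0) (hxc₂ : B₀ σ N x c₂ = 0)
    (h11 : Valued.v (B₀ σ N c₁ c₁) ≤ Valued.v ϖ ^ 2) (h22 : Valued.v (B₀ σ N c₂ c₂) ≤ Valued.v ϖ ^ 2)
    (h12 : Valued.v (B₀ σ N c₁ c₂) = Valued.v ϖ) (h21 : Valued.v (B₀ σ N c₂ c₁) = Valued.v ϖ)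
    {w : Fin 3 → K} (hw : ∀ i, Valued.v (w i) ≤ 1) (hunit : ∃ k, Valued.v (w k) = 1)
    (hiso : B₀ σ N (w 0 • x + w 1 • c₁ + w 2 • c₂) (w 0 • x + w 1 • c₁ + w 2 • c₂) = 0) :
    ∃ x' f₀ f₂ : Fin N → K, x' ∈ M ∧ f₀ ∈ M ∧ f₂ ∈ M ∧ Valued.v (B₀ σ N x' x') = 1 ∧ B₀ σ N x' f₀ = 0 ∧ B₀ σ N x' f₂ = 0 ∧
      B₀ σ N f₀ f₀ = 0 ∧ B₀ σ N f₂ f₂ = 0 ∧ B₀ σ N f₀ f₂ = ϖ := by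
  have hϖ0 : ϖ ≠ 0 := uniformizer_ne_zero hϖ
  have hvϖ0 : Valued.v ϖ ≠ 0 := (Valuation.ne_zero_iff Valued.v).2 hϖ0
  have hϖ1 : Valued.v ϖ < 1 := by rw [hϖ, ← WithZero.exp_zero, WithZero.exp_lt_exp]; omega
  have hϖ2 : Valued.v ϖ ^ 2 < Valued.v ϖ := by rw [pow_two]; exact mul_lt_of_lt_one_left (zero_lt_iff.2 hvϖ0) hϖ1
  have hlt : ∀ a : K, Valued.v a < 1 ↔ Valued.v a ≤ Valued.v ϖ := fun a => by rw [hϖ]; exact v_lt_one_iff a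
  have herm : ∀ y z : Fin N → K, B₀ σ N z y = σ (B₀ σ N y z) := fun y z => (isHermitianForm_B₀ hσ y z).symm
  obtain ⟨f₀, hf₀⟩ : ∃ f₀ : Fin N → K, f₀ = w 0 • x + w 1 • c₁ + w 2 • c₂ := ⟨_, rfl⟩
  rw [← hf₀] at hiso
  have hf₀M : f₀ ∈ M := by
    rw [hf₀]; exact M.add_mem (M.add_mem (smul_mem_of_v_le _ (hw 0) hxM) (smul_mem_of_v_le _ (hw 1) hc₁M)) (smul_mem_of_v_le _ (hw 2) hc₂M)
  have hc₁x : B₀ σ N c₁ x = 0 := by rw [herm, hxc₁, map_zero]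
  have hc₂x : B₀ σ N c₂ x = 0 := by rw [herm, hxc₂, map_zero]
  -- the three pairings `u_a = h(f₀, ·)`
  have hu₀ : B₀ σ N f₀ x = σ (w 0) * B₀ σ N x x := by
    rw [hf₀]; simp only [map_add, LinearMap.add_apply, form_smul_left, hc₁x, hc₂x]; ring
  have hu₁ : B₀ σ N f₀ c₁ = σ (w 1) * B₀ σ N c₁ c₁ + σ (w 2) * B₀ σ N c₂ c₁ := by
    rw [hf₀]; simp only [map_add, LinearMap.add_apply, form_smul_left, hxc₁]; ring
  have hu₂ : B₀ σ N f₀ c₂ = σ (w 1) * B₀ σ N c₁ c₂ + σ (w 2) * B₀ σ N c₂ c₂ := by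
    rw [hf₀]; simp only [map_add, LinearMap.add_apply, form_smul_left, hxc₂]; ring
  have hvu₁ : Valued.v (B₀ σ N f₀ c₁) ≤ Valued.v ϖ := by
    rw [hu₁]
    refine (Valuation.map_add _ _ _).trans (max_le ?_ ?_)
    · rw [map_mul, hvσ]; exact (mul_le_of_le_one_left' (hw 1)).trans (h11.trans hϖ2.le)
    · rw [map_mul, hvσ, h21]; exact mul_le_of_le_one_left' (hw 2)
  have hvu₂ : Valued.v (B₀ σ N f₀ c₂) ≤ Valued.v ϖ := by
    rw [hu₂]
    refine (Valuation.map_add _ _ _).trans (max_le ?_ ?_)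
    · rw [map_mul, hvσ, h12]; exact mul_le_of_le_one_left' (hw 1)
    · rw [map_mul, hvσ]; exact (mul_le_of_le_one_left' (hw 2)).trans (h22.trans hϖ2.le)
  -- isotropy: `h(f₀,f₀) = w₀u₀ + w₁u₁ + w₂u₂ = 0` forces `|w₀| ≤ |ϖ|`
  have hexp : B₀ σ N x x * (σ (w 0) * w 0) = -(w 1 * B₀ σ N f₀ c₁ + w 2 * B₀ σ N f₀ c₂) := by
    have h : B₀ σ N f₀ (w 0 • x + w 1 • c₁ + w 2 • c₂) = w 0 * B₀ σ N f₀ x + w 1 * B₀ σ N f₀ c₁ + w 2 * B₀ σ N f₀ c₂ := by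
      rw [map_add, map_add, form_smul_right, form_smul_right, form_smul_right]
    rw [← hf₀] at h
    rw [h, hu₀] at hiso
    linear_combination hiso
  have hw0 : Valued.v (w 0) ≤ Valued.v ϖ := by
    have hprod : Valued.v (σ (w 0) * w 0) ≤ Valued.v ϖ := by
      have h := congrArg Valued.v hexp
      rw [map_mul, hx, one_mul, Valuation.map_neg] at h
      rw [h]
      refine (Valuation.map_add _ _ _).trans (max_le ?_ ?_)
      · rw [map_mul]; exact (mul_le_of_le_one_left' (hw 1)).trans hvu₁
      · rw [map_mul]; exact (mul_le_of_le_one_left' (hw 2)).trans hvu₂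
    rw [← hlt]
    by_contra hge
    have h1 : Valued.v (w 0) = 1 := le_antisymm (hw 0) (not_lt.1 hge)
    rw [map_mul, hvσ, h1, one_mul] at hprod
    exact not_lt.2 hprod hϖ1
  have hf₀x : Valued.v (B₀ σ N f₀ x) ≤ Valued.v ϖ := by rw [hu₀, map_mul, hvσ, hx, mul_one]; exact hw0
  -- the unit coordinate is `w₁` or `w₂`
  obtain ⟨k, hk⟩ := hunit
  have hcase : Valued.v (w 1) = 1 ∨ Valued.v (w 2) = 1 := by
    fin_cases k
    · exfalso; simp only [Fin.zero_eta] at hk; rw [hk] at hw0; exact not_lt.2 hw0 hϖ1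
    · exact Or.inl hk
    · exact Or.inr hk
  rcases hcase with h1 | h2
  · -- `w₁` a unit: `|h(f₀,c₂)| = |ϖ|`, partner `c₂`
    have hf₀c₂ : Valued.v (B₀ σ N f₀ c₂) = Valued.v ϖ := by
      rw [hu₂]
      refine (Valuation.map_add_eq_of_lt_left _ ?_).trans (by rw [map_mul, hvσ, h1, one_mul, h12])
      rw [map_mul, map_mul, hvσ, hvσ, h1, one_mul, h12]
      exact lt_of_le_of_lt (mul_le_of_le_one_left' (hw 2)) (lt_of_le_of_lt h22 hϖ2)
    obtain ⟨x', f₂, hx'M, hf₂M, hx', hx'f₀, hx'f₂, hf₂f₂, hf₀f₂⟩ := exists_adapted_vectors_of_isotropic_of_ramified hσ hvσ hϖ hres heven h20 M hxM hf₀M hc₂M hx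
      hiso hxc₂ hf₀x hf₀c₂ h22
    exact ⟨x', f₀, f₂, hx'M, hf₀M, hf₂M, hx', hx'f₀, hx'f₂, hiso, hf₂f₂, hf₀f₂⟩
  · -- `w₂` a unit: `|h(f₀,c₁)| = |ϖ|`, partner `c₁`
    have hf₀c₁ : Valued.v (B₀ σ N f₀ c₁) = Valued.v ϖ := by
      rw [hu₁, add_comm]
      refine (Valuation.map_add_eq_of_lt_left _ ?_).trans (by rw [map_mul, hvσ, h2, one_mul, h21])
      rw [map_mul, map_mul, hvσ, hvσ, h2, one_mul, h21]
      exact lt_of_le_of_lt (mul_le_of_le_one_left' (hw 1)) (lt_of_le_of_lt h11 hϖ2)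
    obtain ⟨x', f₂, hx'M, hf₂M, hx', hx'f₀, hx'f₂, hf₂f₂, hf₀f₂⟩ := exists_adapted_vectors_of_isotropic_of_ramified hσ hvσ hϖ hres heven h20 M hxM hf₀M hc₁M hx
      hiso hxc₁ hf₀x hf₀c₁ h11
    exact ⟨x', f₀, f₂, hx'M, hf₀M, hf₂M, hx', hx'f₀, hx'f₂, hiso, hf₂f₂, hf₀f₂⟩

/-! ## §2 The adapted vectors of a type-two vertex at a ramified place -/

/-- **ADAPTED VECTORS OF A TYPE-TWO VERTEX AT ANY RAMIFIED PLACE** (twin of ★ `exists_adapted_vectors_of_isVertexLattice_two_of_neg` without `|2| = 1`, `σϖ = −ϖ`, `hnorm`).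
Every type-two vertex lattice `M` of `(K³, J₀)` contains `x, f₀, f₂` with `|h(x,x)| = 1`, `x ⊥ f₀, f₂`, `h(f₀,f₀) = h(f₂,f₂) = 0`, `h(f₀,f₂) = ϖ`: FILE 1's orthogonal basis `g`
and type-two block; `f₀ = g·w` with `w` the PRIMITIVE normalisation (★ `exists_inv_smul_mem_stdLattice`) of the coordinates `g⁻¹e₀` of the isotropic `e₀` (`(J₀)₀₀ = 0`), so
`f₀ ∈ (𝒪 ∖ 𝔪)·e₀` is isotropic; then §1. [cite: Jacobowitz1962, §4, §9, §11] [cite: Omeara1963, §81A, §82F] -/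
theorem exists_adapted_vectors_of_isVertexLattice_two_of_ramified [Finite 𝓀[K]] (hσ : ∀ x, σ (σ x) = x) (hvσ : ∀ a, Valued.v (σ a) = Valued.v a)
    (hϖ : Valued.v ϖ = WithZero.exp (-1 : ℤ)) (hres : ∀ x : K, Valued.v x ≤ 1 → Valued.v (σ x - x) < 1)
    (heven : ∀ x : K, σ x = x → x ≠ 0 → ∃ n : ℤ, Valued.v x = WithZero.exp (2 * n)) (h20 : (2 : K) ≠ 0)
    {M : Submodule 𝒪[K] (Fin 3 → K)} (hM : IsVertexLattice σ ϖ ((StdForm.antidiagonal 3).over K) 2 M) :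
    ∃ x f₀ f₂ : Fin 3 → K, x ∈ M ∧ f₀ ∈ M ∧ f₂ ∈ M ∧ Valued.v (B₀ σ 3 x x) = 1 ∧ B₀ σ 3 x f₀ = 0 ∧ B₀ σ 3 x f₂ = 0 ∧
      B₀ σ 3 f₀ f₀ = 0 ∧ B₀ σ 3 f₂ f₂ = 0 ∧ B₀ σ 3 f₀ f₂ = ϖ := by
  obtain ⟨g, rfl, hx, h01, h02⟩ := exists_orthogonal_basis_of_adjugate hσ hvσ hϖ hM
  obtain ⟨h11, h22, h12, h21⟩ := typeTwo_block_of_ramified hσ hvσ hϖ heven hM hx h01 h02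
  -- the coordinates of `e₀` in the basis `g`, normalised to a primitive vector `w`
  set p : Fin 3 → K := ((g⁻¹ : GL (Fin 3) K) : Matrix (Fin 3) (Fin 3) K).mulVec (Pi.single 0 1) with hp
  have hgp : (g : Matrix (Fin 3) (Fin 3) K).mulVec p = Pi.single 0 1 := by
    rw [hp, Matrix.mulVec_mulVec, ← Units.val_mul, mul_inv_cancel, Units.val_one, Matrix.one_mulVec]
  have hp0 : p ≠ 0 := by
    intro h
    have h1 := congrFun hgp 0
    rw [h, Matrix.mulVec_zero, Pi.zero_apply, Pi.single_eq_same] at h1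
    exact zero_ne_one h1
  obtain ⟨k, hpk, hwint, hwk⟩ := exists_inv_smul_mem_stdLattice hp0
  set w : Fin 3 → K := (p k)⁻¹ • p with hw
  have hwv : ∀ i, Valued.v (w i) ≤ 1 := hwint
  have hunit : ∃ k, Valued.v (w k) = 1 := ⟨k, by rw [hwk, map_one]⟩
  -- `f₀ = g·w = (p k)⁻¹ e₀` is isotropic and equals `w₀x + w₁c₁ + w₂c₂`
  have hgw : (g : Matrix (Fin 3) (Fin 3) K).mulVec w = (p k)⁻¹ • Pi.single 0 1 := by rw [hw, Matrix.mulVec_smul, hgp]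
  have hw3 : w = w 0 • Pi.single 0 1 + w 1 • Pi.single 1 1 + w 2 • Pi.single 2 1 := by
    ext i; fin_cases i <;> simp
  have hf₀eq : (g : Matrix (Fin 3) (Fin 3) K).mulVec w = w 0 • (g : Matrix (Fin 3) (Fin 3) K).mulVec (Pi.single 0 1) +
      w 1 • (g : Matrix (Fin 3) (Fin 3) K).mulVec (Pi.single 1 1) + w 2 • (g : Matrix (Fin 3) (Fin 3) K).mulVec (Pi.single 2 1) := by
    conv_lhs => rw [hw3]
    rw [Matrix.mulVec_add, Matrix.mulVec_add, Matrix.mulVec_smul, Matrix.mulVec_smul, Matrix.mulVec_smul]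
  have hiso : B₀ σ 3 ((g : Matrix (Fin 3) (Fin 3) K).mulVec w) ((g : Matrix (Fin 3) (Fin 3) K).mulVec w) = 0 := by
    rw [hgw, form_smul_left, form_smul_right, B₀_single_single_self_eq_zero (by decide), mul_zero, mul_zero]
  rw [hf₀eq] at hiso
  exact exists_adapted_vectors_of_frame_of_ramified hσ hvσ hϖ hres heven h20 _ (mulVec_single_mem_latt _ 0) (mulVec_single_mem_latt _ 1) (mulVec_single_mem_latt _ 2)
    hx h01 h02 h11 h22 h12 h21 hwv hunit hiso

/-! ## §3 Type-two transitivity at every ramified place -/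

set_option maxHeartbeats 800000 in
/-- **`U(σ, J₀)` IS TRANSITIVE ON THE TYPE-TWO VERTICES AT EVERY RAMIFIED PLACE, WILD ONES INCLUDED** (`N = 3`; twin of ★ `exists_mapGL_N₁_eq_of_isVertexLattice_two_of_neg` with
`σϖ` general and no `|2| = 1` ∕ `hnorm`): every type-two vertex lattice `M` of `(K³, J₀)` is `u·N₁`, `N₁ = latt diag(1,1,ϖ)`, for some `u ∈ U(σ, J₀)`.  From the adapted vectors
`x, f₀, f₂ ∈ M` (§2): the Gram matrix of `C = (f₀ | x | f₂)` is `[[0,0,ϖ],[0,ε,0],[σϖ,0,0]]` of determinant `−εϖσϖ = −N(det C)`, so `ε = N(det C ∕ ϖ)`; `c₁ = (det C∕ϖ)⁻¹x` has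
`h(c₁,c₁) = 1`; `u = (f₀ | c₁ | ϖ⁻¹f₂)` satisfies `ᵗσ(u)J₀u = J₀` (`σ(ϖ⁻¹)·σϖ = 1`) and `u·N₁ = latt(f₀|c₁|f₂) ≤ M`, two type-two vertices (★ `isVertexLattice_two_N₁_of_v`), equal
by ★ (D1)∕(D2) `eq_of_le_of_isVertexLattice`. [cite: Jacobowitz1962, §§9–11, Thm. 11.4] [cite: BruhatTits1972, §10] -/
theorem exists_mapGL_N₁_eq_of_isVertexLattice_two_of_ramified [Finite 𝓀[K]] (hσ : ∀ x, σ (σ x) = x) (hvσ : ∀ a, Valued.v (σ a) = Valued.v a)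
    (hϖ : Valued.v ϖ = WithZero.exp (-1 : ℤ)) (hres : ∀ x : K, Valued.v x ≤ 1 → Valued.v (σ x - x) < 1)
    (heven : ∀ x : K, σ x = x → x ≠ 0 → ∃ n : ℤ, Valued.v x = WithZero.exp (2 * n)) (h20 : (2 : K) ≠ 0)
    {M : Submodule 𝒪[K] (Fin 3 → K)} (hM : IsVertexLattice σ ϖ ((StdForm.antidiagonal 3).over K) 2 M) :
    ∃ u : unitaryGroupOfForm σ ((StdForm.antidiagonal 3).over K), M = mapGL (u : GL (Fin 3) K) (latt (Matrix.diagonal ![(1 : K), 1, ϖ])) := by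
  have hϖ0 : ϖ ≠ 0 := uniformizer_ne_zero hϖ
  have hσϖ0 : σ ϖ ≠ 0 := (map_ne_zero σ).2 hϖ0
  have hϖ1 : Valued.v ϖ ≤ 1 := by rw [hϖ, ← WithZero.exp_zero]; exact WithZero.exp_le_exp.2 (by norm_num)
  have herm : ∀ y z : Fin 3 → K, B₀ σ 3 z y = σ (B₀ σ 3 y z) := fun y z => (isHermitianForm_B₀ hσ y z).symm
  obtain ⟨x, f₀, f₂, hxM, hf₀M, hf₂M, hx, hxf₀, hxf₂, hf₀f₀, hf₂f₂, hf₀f₂⟩ :=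
    exists_adapted_vectors_of_isVertexLattice_two_of_ramified hσ hvσ hϖ hres heven h20 hM
  have hε0 : B₀ σ 3 x x ≠ 0 := fun h => by rw [h, map_zero] at hx; exact zero_ne_one hx
  have hf₀x : B₀ σ 3 f₀ x = 0 := by rw [herm, hxf₀, map_zero]
  have hf₂x : B₀ σ 3 f₂ x = 0 := by rw [herm, hxf₂, map_zero]
  have hf₂f₀ : B₀ σ 3 f₂ f₀ = σ ϖ := by rw [herm, hf₀f₂]
  -- the determinant class `h(x,x) = N(z)`, `z = det C / ϖ`
  set C : Matrix (Fin 3) (Fin 3) K := (Matrix.of ![f₀, x, f₂])ᵀ with hC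
  have hC0 : C.mulVec (Pi.single 0 1) = f₀ := transpose_of_mulVec_single _ 0
  have hC1 : C.mulVec (Pi.single 1 1) = x := transpose_of_mulVec_single _ 1
  have hC2 : C.mulVec (Pi.single 2 1) = f₂ := transpose_of_mulVec_single _ 2
  have hGram : (C.map σ)ᵀ * (StdForm.antidiagonal 3).over K * C = !![0, 0, ϖ; 0, B₀ σ 3 x x, 0; σ ϖ, 0, 0] := by
    ext i j
    rw [← B₀_mulVec_single_eq_gram]
    fin_cases i <;> fin_cases j <;>
      simp only [Fin.zero_eta, Fin.mk_one, Fin.reduceFinMk, hC0, hC1, hC2, hf₀f₀, hf₀x, hf₀f₂, hxf₀, hxf₂, hf₂f₀, hf₂x, hf₂f₂] <;> rfl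
  have hdetC : σ C.det * C.det = B₀ σ 3 x x * (ϖ * σ ϖ) := by
    have hdet3 : (!![0, 0, ϖ; 0, B₀ σ 3 x x, 0; σ ϖ, 0, 0] : Matrix (Fin 3) (Fin 3) K).det = -(B₀ σ 3 x x * (ϖ * σ ϖ)) := by
      simp [Matrix.det_fin_three]; ring
    have h := det_gram_three (σ := σ) C
    rw [hGram, hdet3] at h
    linear_combination h
  set z : K := C.det / ϖ with hz
  have hzz : σ z * z = B₀ σ 3 x x := by
    rw [hz, map_div₀, div_mul_div_comm, hdetC, mul_comm (σ ϖ) ϖ, mul_div_assoc, div_self (mul_ne_zero hϖ0 hσϖ0), mul_one]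
  have hvz : Valued.v z = 1 := by
    apply eq_one_of_mul_self_eq_one
    rw [show Valued.v z * Valued.v z = Valued.v (σ z * z) by rw [map_mul, hvσ], hzz]; exact hx
  have hz0 : z ≠ 0 := fun h => by rw [h, map_zero] at hvz; exact zero_ne_one hvz
  have hσz0 : σ z ≠ 0 := (map_ne_zero σ).2 hz0
  -- the unit vector `c₁ = z⁻¹ x`
  set c₁ : Fin 3 → K := z⁻¹ • x with hc₁
  have hc₁M : c₁ ∈ M := smul_mem_of_v_le _ (by rw [map_inv₀, hvz, inv_one]) hxM
  have hc₁c₁ : B₀ σ 3 c₁ c₁ = 1 := by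
    rw [hc₁, form_smul_left, form_smul_right, ← hzz, map_inv₀]; field_simp
  have hc₁f₀ : B₀ σ 3 c₁ f₀ = 0 := by rw [hc₁, form_smul_left, hxf₀, mul_zero]
  have hc₁f₂ : B₀ σ 3 c₁ f₂ = 0 := by rw [hc₁, form_smul_left, hxf₂, mul_zero]
  have hf₀c₁ : B₀ σ 3 f₀ c₁ = 0 := by rw [herm, hc₁f₀, map_zero]
  have hf₂c₁ : B₀ σ 3 f₂ c₁ = 0 := by rw [herm, hc₁f₂, map_zero]
  -- the unitary matrix `u = (f₀ | c₁ | ϖ⁻¹ f₂)`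
  have hσϖi : σ ϖ⁻¹ = (σ ϖ)⁻¹ := map_inv₀ σ ϖ
  set U : Matrix (Fin 3) (Fin 3) K := (Matrix.of ![f₀, c₁, ϖ⁻¹ • f₂])ᵀ with hU
  have hU0 : U.mulVec (Pi.single 0 1) = f₀ := transpose_of_mulVec_single _ 0
  have hU1 : U.mulVec (Pi.single 1 1) = c₁ := transpose_of_mulVec_single _ 1
  have hU2 : U.mulVec (Pi.single 2 1) = ϖ⁻¹ • f₂ := transpose_of_mulVec_single _ 2
  have hUJ : (U.map σ)ᵀ * (StdForm.antidiagonal 3).over K * U = (StdForm.antidiagonal 3).over K := by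
    ext i j
    rw [← B₀_mulVec_single_eq_gram, UnitaryGroup.antidiagonal_three_over_eq]
    fin_cases i <;> fin_cases j <;>
      simp only [Fin.zero_eta, Fin.mk_one, Fin.reduceFinMk, hU0, hU1, hU2, form_smul_left, form_smul_right, hσϖi, hf₀f₀, hf₀c₁, hf₀f₂, hc₁f₀, hc₁c₁, hc₁f₂,
        hf₂f₀, hf₂c₁, hf₂f₂, mul_zero, inv_mul_cancel₀ hϖ0, inv_mul_cancel₀ hσϖ0] <;> rfl
  have hdetU : U.det ≠ 0 := by
    intro h
    have h2' := congrArg Matrix.det hUJ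
    rw [det_gram_three, h, mul_zero, neg_zero, det_antidiagonal_three] at h2'
    norm_num at h2'
  set u : GL (Fin 3) K := Matrix.GeneralLinearGroup.mkOfDetNeZero U hdetU with hu
  have huval : (u : Matrix (Fin 3) (Fin 3) K) = U := rfl
  have huU : u ∈ unitaryGroupOfForm σ ((StdForm.antidiagonal 3).over K) := by rw [mem_unitaryGroupOfForm_iff, huval]; exact hUJ
  refine ⟨⟨u, huU⟩, ?_⟩
  change M = mapGL u (latt (Matrix.diagonal ![(1 : K), 1, ϖ]))
  -- `u·N₁ = latt (f₀ | c₁ | f₂) ≤ M`, both type two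
  have hle : mapGL u (latt (Matrix.diagonal ![(1 : K), 1, ϖ])) ≤ M := by
    rw [mapGL_latt_eq, huval, latt_le_iff_forall_mulVec_single_mem]
    intro j
    rw [← Matrix.mulVec_mulVec, Matrix.diagonal_mulVec_single, mul_one]
    fin_cases j
    · simp only [Fin.zero_eta]; rw [show (![(1 : K), 1, ϖ] : Fin 3 → K) 0 = 1 from rfl, hU0]; exact hf₀M
    · simp only [Fin.mk_one]; rw [show (![(1 : K), 1, ϖ] : Fin 3 → K) 1 = 1 from rfl, hU1]; exact hc₁M
    · simp only [Fin.reduceFinMk]; rw [show (![(1 : K), 1, ϖ] : Fin 3 → K) 2 = ϖ from rfl]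
      have h2'' : (Pi.single 2 ϖ : Fin 3 → K) = ϖ • Pi.single 2 1 := by
        ext i; rw [Pi.smul_apply, Pi.single_apply, Pi.single_apply, smul_eq_mul, mul_ite, mul_one, mul_zero]
      rw [h2'', Matrix.mulVec_smul, hU2, smul_smul, mul_inv_cancel₀ hϖ0, one_smul]; exact hf₂M
  have htwo : IsVertexLattice σ ϖ ((StdForm.antidiagonal 3).over K) 2 (mapGL u (latt (Matrix.diagonal ![(1 : K), 1, ϖ]))) :=
    isVertexLattice_mapGL σ ϖ _ u huU (isVertexLattice_two_N₁_of_v hvσ hϖ1 hϖ0)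
  exact (eq_of_le_of_isVertexLattice hvσ hϖ0 htwo hM hle).symm

/-- **The binder `htr₂` of ★ `isTree_latticeGraph_three_of_transitive` holds at EVERY ramified place — tame, ramified-prime and ramified-unit (wild dyadic) alike**:
hypotheses ⊆ the conjuncts of `IsRamifiedQuadraticDatum σ ϖ d t` (`σ` an isometric involution, `ϖ` a uniformiser, residual triviality, even valuation of `σ`-fixed elements,
`2 ≠ 0`) + a finite residue field; no `|2| = 1`, no `σϖ = −ϖ`, no first-order norm property. [cite: Jacobowitz1962, §§9–11, Thm. 11.4] [cite: BruhatTits1972, §10] [cite: Tits1979, §2.4] -/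
theorem forall_isVertexLattice_two_exists_mapGL_N₁_eq_of_ramified [Finite 𝓀[K]] (hσ : ∀ x, σ (σ x) = x) (hvσ : ∀ a, Valued.v (σ a) = Valued.v a)
    (hϖ : Valued.v ϖ = WithZero.exp (-1 : ℤ)) (hres : ∀ x : K, Valued.v x ≤ 1 → Valued.v (σ x - x) < 1)
    (heven : ∀ x : K, σ x = x → x ≠ 0 → ∃ n : ℤ, Valued.v x = WithZero.exp (2 * n)) (h20 : (2 : K) ≠ 0) :
    ∀ M : Submodule 𝒪[K] (Fin 3 → K), IsVertexLattice σ ϖ ((StdForm.antidiagonal 3).over K) 2 M →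
      ∃ u : unitaryGroupOfForm σ ((StdForm.antidiagonal 3).over K), M = mapGL (u : GL (Fin 3) K) (latt (Matrix.diagonal ![(1 : K), 1, ϖ])) :=
  fun _ hM => exists_mapGL_N₁_eq_of_isVertexLattice_two_of_ramified hσ hvσ hϖ hres heven h20 hM

end Literature.NumberTheory.Automorphic.UnitaryLatticeTree

end
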